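import Mathlib.Analysis.InnerProductSpace.Basic
import Literature.MathematicalPhysics.QuantumFieldTheory.Balaban1983to89.B4Eq19LatticeOperators
import HarnessLib

/-!
# Line «poincare_lipschitz» on crux `HistoryTailL` (stmt-QuantumFields-19936), route crux `BlockLipschitzL` (stmt-QuantumFields-23533), K2 organ of record LOC-REG-MIN —
# FLAT SHADOW «ENERGY → RANGE» (E→R) FOR LATTICE MINIMISERS INTO A SPHERE, FILE 5a: THE DEPTH RADIUS `σ(y) = ⌊(r′ − ‖y − z‖_∞)₊ ∕ 4⌋` OF THE SCHOEN–UHLENBECK LAYER —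
# sup-distance letters on `ℤ^d`, bond-Lipschitz radius, LEAD's comparability with `A = 2, B = 3`, vanishing in the outer three shells, and the depth band of `Q_{σ(y)+2}(y)`

Cell `ym3-torus` (YM ladder rung R3 = continuum SU(2) Yang–Mills on the three-torus — a RUNG, NOT the Clay problem: not d = 4, not infinite volume, not a mass gap); width seat
`ym-ust-19936-w5` gen 12 (LEAD ym-ust-19936-w1 g8 2026-08-29T05:15:34Z «F4 = ★w5's σ + F2 ∘ F4-core; F5 = ★w5's pen»; 05:29:02Z END-GAME «[C] = E→R F5 + F6»; my LOCATE
`E2R-ROAD-w5g12.md` §2 (ii), §3 F4∕F5).  THEOREMS ONLY (def-free: the sup-distance is written `Finset.univ.sup (fun i => (y i − z i).natAbs)` and the radius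
`(((r′ − ↑(sup…)).toNat ∕ 4 : ℕ) : ℤ)` in place; `θ = ¼` is the literal `∕ 4` so that `omega` closes the counting), lattice letters of lit ✓`B4Eq19LatticeOperators`;
`--supports stmt-QuantumFields-19936`.  Nothing here proves E→R, LOC-REG-MIN, `hReg`, a stub, `BlockLipschitzL`, `HistoryTailL` or a summit statement.

WHY (`E2R-ROAD-w5g12.md` §2 (ii)): the competitor in the boundary layer of `Q_{r′}(z)` is `π(ū_{σ(y)}(y))` with a mollification radius growing linearly with the DEPTH
`r′ + 1 − ‖y − z‖_∞` and VANISHING at the outer boundary (so the competitor IS `u` there — no matching cost); F4 (★w5 ⧗`…VarRadiusMollifier.energy_mollifier_le`) needs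
`σ ≥ 0`, `|σ(y+e_μ) − σ(y)| ≤ 1` and LEAD ★w1's comparability `σ x ≤ A·σ x′ + B` whenever `Q_{σ(x)+2}(x) ∩ Q_{σ(x′)+2}(x′) ≠ ∅`; F5d needs to know in which depth band
`Q_{σ(y)+2}(y)` lies (to feed px8's multi-scale good shell ✓`exists_goodRadius_dyadic`).  All four are here for the explicit radius:
* §1 `natAbs_le_sup`, `sup_natAbs_le_iff`, ★ `mem_box_iff_sup_le` (`y ∈ Q_r(z) ↔ ‖y − z‖_∞ ≤ r`, `d ≥ 1`), ★ `abs_sup_sub_sup_le_of_mem_box`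
  (`x′ ∈ Q_R(x)` ⟹ `|‖x − z‖_∞ − ‖x′ − z‖_∞| ≤ R` — the sup-distance to `z` is 1-Lipschitz for the sup-metric), `mem_box_add_of_mem_mem` (triangle: two boxes sharing a point);
* §2 `depthRadius_nonneg`, ★ `abs_depthRadius_sub_le_one` (bond-Lipschitz EVERYWHERE), ★★ `depthRadius_comparable` (LEAD's `hcomp` with `A = 2`, `B = 3`),
  ★ `depthRadius_eq_zero` (`‖y − z‖_∞ ≥ r′ − 3` ⟹ `σ(y) = 0`), `box_zero_eq_singleton` + `mean_box_zero` (radius `0`: the mollifier IS `u`),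
  ★ `depth_band_of_mem_box_depthRadius` (`y′ ∈ Q_{σ(y)+2}(y)` ⟹ `3(r′ − ‖y−z‖_∞) − 8 ≤ 4(r′ − ‖y′−z‖_∞) ≤ 5(r′ − ‖y−z‖_∞) + 8`).
[folklore] ([SchoenUhlenbeck1982] §4 — mollification radius proportional to the distance from the boundary; the lattice statements are this file's).
-/

set_option autoImplicit false

noncomputable section

open scoped BigOperators
open Finset

namespace Summit.QuantumFields.YangMills.Theorems.PoincareLipschitzSphereMapDepthRadius

open Literature.MathematicalPhysics.QuantumFieldTheory.Balaban1983to89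
open B4Eq19LatticeOperators

variable {d : ℕ}

/-! ## §1 The sup-distance on `ℤ^d` -/

/-- Each coordinate is below the sup: `|y_i − z_i| ≤ ‖y − z‖_∞`. [folklore] -/
theorem natAbs_le_sup (y z : Zd d) (i : Fin d) :
    (((y i - z i).natAbs : ℕ) : ℤ) ≤ ((Finset.univ.sup fun j => (y j - z j).natAbs : ℕ) : ℤ) := by
  exact_mod_cast Finset.le_sup (f := fun j => (y j - z j).natAbs) (Finset.mem_univ i)

/-- `‖y − z‖_∞ ≤ n ↔ ∀ i, |y_i − z_i| ≤ n`. [folklore] -/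
theorem sup_natAbs_le_iff (y z : Zd d) (n : ℕ) :
    (Finset.univ.sup fun j => (y j - z j).natAbs) ≤ n ↔ ∀ i, (y i - z i).natAbs ≤ n := by
  rw [Finset.sup_le_iff]; simp

/-- ★ `y ∈ Q_r(z) ↔ ‖y − z‖_∞ ≤ r` (`d ≥ 1`, so that `r ≥ 0` is forced on both sides). [folklore] [cite: Giaquinta1984, Ch. III §1 p.64] -/
theorem mem_box_iff_sup_le (hd : 0 < d) (y z : Zd d) (r : ℤ) :
    y ∈ box z r ↔ ((Finset.univ.sup fun j => (y j - z j).natAbs : ℕ) : ℤ) ≤ r := by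
  rw [mem_box]
  constructor
  · intro h
    have hr : 0 ≤ r := (abs_nonneg _).trans (h ⟨0, hd⟩)
    have : (Finset.univ.sup fun j => (y j - z j).natAbs) ≤ r.toNat := by
      rw [sup_natAbs_le_iff]
      intro i
      have hi := h i
      have : ((y i - z i).natAbs : ℤ) ≤ r := by rw [Int.natCast_natAbs]; exact hi
      omega
    calc ((Finset.univ.sup fun j => (y j - z j).natAbs : ℕ) : ℤ) ≤ (r.toNat : ℤ) := by exact_mod_cast this
      _ = r := Int.toNat_of_nonneg hr
  · intro h i
    have := natAbs_le_sup y z i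
    rw [Int.natCast_natAbs] at this
    exact this.trans h

/-- One coordinate step of the triangle inequality: `|a + b|ₙ ≤ |a|ₙ + |b|ₙ` read in `ℤ`. [folklore] -/
theorem natAbs_sub_le_natAbs_add (a b c : ℤ) : (((a - c).natAbs : ℕ) : ℤ) ≤ (((a - b).natAbs : ℕ) : ℤ) + (((b - c).natAbs : ℕ) : ℤ) := by
  have e : a - c = (a - b) + (b - c) := by ring
  rw [e]; exact_mod_cast Int.natAbs_add_le _ _

/-- `‖x′ − z‖_∞ ≤ ‖x − z‖_∞ + R` for `x′ ∈ Q_R(x)` (`d ≥ 1`). [folklore] -/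
theorem sup_le_sup_add_of_mem_box (hd : 0 < d) {x x' : Zd d} {R : ℤ} (z : Zd d) (hx' : x' ∈ box x R) :
    ((Finset.univ.sup fun j => (x' j - z j).natAbs : ℕ) : ℤ) ≤ ((Finset.univ.sup fun j => (x j - z j).natAbs : ℕ) : ℤ) + R := by
  rw [mem_box] at hx'
  have hR : 0 ≤ R := (abs_nonneg _).trans (hx' ⟨0, hd⟩)
  have h1 : (Finset.univ.sup fun j => (x' j - z j).natAbs) ≤ (Finset.univ.sup fun j => (x j - z j).natAbs) + R.toNat := by
    rw [sup_natAbs_le_iff]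
    intro i
    have ha := natAbs_le_sup x z i
    have hb : (((x' i - x i).natAbs : ℕ) : ℤ) ≤ R := by rw [Int.natCast_natAbs]; exact hx' i
    have hc := natAbs_sub_le_natAbs_add (x' i) (x i) (z i)
    omega
  calc ((Finset.univ.sup fun j => (x' j - z j).natAbs : ℕ) : ℤ) ≤ (((Finset.univ.sup fun j => (x j - z j).natAbs) + R.toNat : ℕ) : ℤ) := by
        exact_mod_cast h1
    _ = _ := by push_cast; rw [Int.toNat_of_nonneg hR]

/-- ★ **The sup-distance to `z` is 1-Lipschitz for the sup-metric**: `x′ ∈ Q_R(x)` ⟹ `|‖x − z‖_∞ − ‖x′ − z‖_∞| ≤ R` (`d ≥ 1`). [folklore] -/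
theorem abs_sup_sub_sup_le_of_mem_box (hd : 0 < d) {x x' : Zd d} {R : ℤ} (z : Zd d) (hx' : x' ∈ box x R) :
    |((Finset.univ.sup fun j => (x j - z j).natAbs : ℕ) : ℤ) - ((Finset.univ.sup fun j => (x' j - z j).natAbs : ℕ) : ℤ)| ≤ R := by
  have h1 := sup_le_sup_add_of_mem_box hd z hx'
  have h2 := sup_le_sup_add_of_mem_box hd z (mem_box_comm.1 hx')
  rw [abs_le]; constructor <;> linarith

/-- Two boxes sharing a point: `y ∈ Q_R(x) ∩ Q_{R′}(x′)` ⟹ `x′ ∈ Q_{R+R′}(x)`. [folklore] -/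
theorem mem_box_add_of_mem_mem {x x' y : Zd d} {R R' : ℤ} (hy : y ∈ box x R) (hy' : y ∈ box x' R') : x' ∈ box x (R + R') := by
  rw [mem_box] at hy hy' ⊢
  intro i
  have h1 := hy i
  have h2 := hy' i
  have e : x' i - x i = (y i - x i) - (y i - x' i) := by ring
  rw [e]
  exact (abs_sub _ _).trans (by linarith)

/-! ## §2 The depth radius `σ(y) = ⌊(r′ − ‖y − z‖_∞)₊ ∕ 4⌋` -/

/-- `σ ≥ 0`. [folklore] -/
theorem depthRadius_nonneg (z : Zd d) (r' : ℤ) (y : Zd d) :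
    (0 : ℤ) ≤ (((r' - ((Finset.univ.sup fun j => (y j - z j).natAbs : ℕ) : ℤ)).toNat / 4 : ℕ) : ℤ) := by
  exact_mod_cast Nat.zero_le _

/-- ★ **BOND-LIPSCHITZ, EVERYWHERE**: `|σ(y + e_μ) − σ(y)| ≤ 1` (`d ≥ 1`). [folklore] -/
theorem abs_depthRadius_sub_le_one (hd : 0 < d) (z : Zd d) (r' : ℤ) (y : Zd d) (μ : Fin d) :
    |(((r' - ((Finset.univ.sup fun j => ((y + unitVec μ) j - z j).natAbs : ℕ) : ℤ)).toNat / 4 : ℕ) : ℤ) -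
      (((r' - ((Finset.univ.sup fun j => (y j - z j).natAbs : ℕ) : ℤ)).toNat / 4 : ℕ) : ℤ)| ≤ 1 := by
  have hmem : y + unitVec μ ∈ box y 1 := by
    have := add_unitVec_mem_box (self_mem_box y le_rfl) μ
    simpa using this
  have h := abs_sup_sub_sup_le_of_mem_box hd z hmem
  set a : ℤ := ((Finset.univ.sup fun j => (y j - z j).natAbs : ℕ) : ℤ)
  set b : ℤ := ((Finset.univ.sup fun j => ((y + unitVec μ) j - z j).natAbs : ℕ) : ℤ)
  rw [abs_le] at h ⊢
  constructor <;> omega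

/-- ★★ **LEAD's COMPARABILITY with `A = 2`, `B = 3`**: if `Q_{σ(x)+2}(x)` and `Q_{σ(x′)+2}(x′)` share a point then `σ(x) ≤ 2·σ(x′) + 3` (`d ≥ 1`; `θ = ¼`).
[folklore] [cite: SchoenUhlenbeck1982, §4] -/
theorem depthRadius_comparable (hd : 0 < d) (z : Zd d) (r' : ℤ) (x x' y : Zd d)
    (hy : y ∈ box x ((((r' - ((Finset.univ.sup fun j => (x j - z j).natAbs : ℕ) : ℤ)).toNat / 4 : ℕ) : ℤ) + 2))
    (hy' : y ∈ box x' ((((r' - ((Finset.univ.sup fun j => (x' j - z j).natAbs : ℕ) : ℤ)).toNat / 4 : ℕ) : ℤ) + 2)) :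
    (((r' - ((Finset.univ.sup fun j => (x j - z j).natAbs : ℕ) : ℤ)).toNat / 4 : ℕ) : ℤ) ≤
      (2 : ℤ) * (((r' - ((Finset.univ.sup fun j => (x' j - z j).natAbs : ℕ) : ℤ)).toNat / 4 : ℕ) : ℤ) + (3 : ℕ) := by
  have hxx' := mem_box_add_of_mem_mem hy hy'
  have h := abs_sup_sub_sup_le_of_mem_box hd z hxx'
  set a : ℤ := ((Finset.univ.sup fun j => (x j - z j).natAbs : ℕ) : ℤ)
  set a' : ℤ := ((Finset.univ.sup fun j => (x' j - z j).natAbs : ℕ) : ℤ)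
  rw [abs_le] at h
  push_cast
  omega

/-- ★ **VANISHING IN THE OUTER THREE SHELLS**: `‖y − z‖_∞ ≥ r′ − 3` ⟹ `σ(y) = 0` — there the mollifier has radius `0` and the competitor IS `u`. [folklore] -/
theorem depthRadius_eq_zero (z : Zd d) (r' : ℤ) (y : Zd d) (hy : r' - 3 ≤ ((Finset.univ.sup fun j => (y j - z j).natAbs : ℕ) : ℤ)) :
    (((r' - ((Finset.univ.sup fun j => (y j - z j).natAbs : ℕ) : ℤ)).toNat / 4 : ℕ) : ℤ) = 0 := by
  have : ((r' - ((Finset.univ.sup fun j => (y j - z j).natAbs : ℕ) : ℤ)).toNat / 4 : ℕ) = 0 := by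
    apply Nat.div_eq_of_lt; omega
  rw [this]; rfl

/-- The box of radius `0` is the centre. [folklore] -/
theorem box_zero_eq_singleton (y : Zd d) : box y 0 = {y} := by
  ext w
  rw [mem_box, Finset.mem_singleton]
  constructor
  · intro h; funext i; have := h i; rw [abs_nonpos_iff, sub_eq_zero] at this; exact this
  · rintro rfl i; simp

/-- At radius `0` the mollifier is the field itself: `(#Q_0(y))⁻¹ • Σ_{Q_0(y)} u = u y`. [folklore] -/
theorem mean_box_zero {V : Type*} [AddCommGroup V] [Module ℝ V] (u : Zd d → V) (y : Zd d) :
    (((box y 0).card : ℝ))⁻¹ • ∑ w ∈ box y 0, u w = u y := by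
  rw [box_zero_eq_singleton]; simp

/-- ★ **THE DEPTH BAND OF `Q_{σ(y)+2}(y)`**: `y′ ∈ Q_{σ(y)+2}(y)` ⟹ `3·(r′ − ‖y − z‖_∞) − 8 ≤ 4·(r′ − ‖y′ − z‖_∞) ≤ 5·(r′ − ‖y − z‖_∞) + 8` whenever
`‖y − z‖_∞ ≤ r′` (`d ≥ 1`) — the mollifier at depth `t` only reads depths in `[¾t − 2, ⁵⁄₄t + 2]`. [folklore] -/
theorem depth_band_of_mem_box_depthRadius (hd : 0 < d) (z : Zd d) (r' : ℤ) (y y' : Zd d)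
    (hyz : ((Finset.univ.sup fun j => (y j - z j).natAbs : ℕ) : ℤ) ≤ r')
    (hy' : y' ∈ box y ((((r' - ((Finset.univ.sup fun j => (y j - z j).natAbs : ℕ) : ℤ)).toNat / 4 : ℕ) : ℤ) + 2)) :
    3 * (r' - ((Finset.univ.sup fun j => (y j - z j).natAbs : ℕ) : ℤ)) - 8 ≤ 4 * (r' - ((Finset.univ.sup fun j => (y' j - z j).natAbs : ℕ) : ℤ)) ∧
      4 * (r' - ((Finset.univ.sup fun j => (y' j - z j).natAbs : ℕ) : ℤ)) ≤ 5 * (r' - ((Finset.univ.sup fun j => (y j - z j).natAbs : ℕ) : ℤ)) + 8 := by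
  have h := abs_sup_sub_sup_le_of_mem_box hd z hy'
  set a : ℤ := ((Finset.univ.sup fun j => (y j - z j).natAbs : ℕ) : ℤ)
  set a' : ℤ := ((Finset.univ.sup fun j => (y' j - z j).natAbs : ℕ) : ℤ)
  rw [abs_le] at h
  have ht : (((r' - a).toNat : ℕ) : ℤ) = r' - a := Int.toNat_of_nonneg (by linarith)
  push_cast at h
  constructor <;> omega

end Summit.QuantumFields.YangMills.Theorems.PoincareLipschitzSphereMapDepthRadius
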